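import Summits.QuantumFields.YangMills.Theorems.BalabanUVNodesN11FluctTruncation
import Literature.MathematicalPhysics.QuantumFieldTheory.Balaban1983to89.Node00.Record13SepCoPHChi
import Literature.MathematicalPhysics.QuantumFieldTheory.Balaban1983to89.Node00.Record13ResidualsRChi
import Summits.QuantumFields.YangMills.Theorems.BalabanUVNodesN11HistoryPinnedResidualDefsChi
import Summits.QuantumFields.YangMills.Theorems.BalabanUVNodesN11RePinnedParamDefsChi
import Summits.QuantumFields.YangMills.Theorems.BalabanUVNodesN11NoExpansionAtRecord13CoPChi
import Summits.QuantumFields.YangMills.Theorems.BalabanUVNodesN11NoExpansionDiagonalCoPHChi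
import Summits.QuantumFields.YangMills.Theorems.BalabanUVNodesN11BackgroundScaleLocalChi
import Summits.QuantumFields.YangMills.Theorems.BalabanUVNodesN11NoExpansionOldFactorsChi
import Summits.QuantumFields.YangMills.Theorems.BalabanUVNodesN11NoExpansionGeneralStepCoPHOldBranchChi
import Summits.QuantumFields.YangMills.Theorems.BalabanUVNodesN11DiagonalOldBranchMeasurableChi
import Summits.QuantumFields.YangMills.Theorems.BalabanUVNodesN11OldBranchPairChi
import Summits.QuantumFields.YangMills.Theorems.BalabanUVNodesN11OldBranchIntegrableOfDominated
import Summits.QuantumFields.YangMills.Theorems.BalabanUVNodesN11NoExpansionGeneralStepGraphChi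
import Summits.QuantumFields.YangMills.Theorems.BalabanUVNodesN11AFibreDominationOfCoercive

/-!
# χ-GENERIC RE-ISSUE (WORK ORDER RC-1) — MERGED MODULE `BalabanUVNodesN11TruncationDominationChi` holding the sibling twins of `BalabanUVNodesN11FluctTruncation`, `BalabanUVNodesN11OldBranchIntegrableOfDominated`, `BalabanUVNodesN11AFibreDominationOfCoercive`

(dag-n11-d g44, N11-σ chain; one file = fewer gate∕farm round-trips; each member keeps its own sibling namespace `…<Member>Chi` and its own header below.)
-/

/-!
# χ-GENERIC RE-ISSUE (WORK ORDER RC-1 «RE-CENTRE THE RECORD», director-ym №462 (B) ∕ №467 (D)) of `BalabanUVNodesN11FluctTruncation`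

Cell `pub-ymgap` (HUMAN RULING D-0062, Track A), seat `pub-ymgap-dag-n11-d` (N11 [B14] s2; N11-σ campaign, `N11-G44-RC1-REACH-CENSUS.md`).  The CENTRE-TYPED
declarations of `BalabanUVNodesN11FluctTruncation` (those whose statement reads the (2.9) cut-off centre through `gOfRecord₁₃ ∕ EOfRecord₁₃ ∕ Provisos₁₃… ∕ T∕SLaw₁₃… ∕
UbgOfRecord₁₃… ∕ WtOfRecord₁₃… ∕ datum∕tower∕coreOfRecord₁₃…`) RE-ISSUED VERBATIM in the β-slot `χ : ChiSlot F N` over [Ax-3b]∕[Ax-3c]∕[Ax-3d]'s χ-generic carriers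
(`Node00/Record13Chi` ∕ `Record13CoPHChi` ∕ `Record13SepCoPHChi`): σ = (binder `(χ : ChiSlot F N)` after `θ`; Node00 defs `X ↦ XChi … χ`; Node00 rows `Y ↦ Y_chi`;
this lane's sibling modules `…Chi` for Summits-side dependencies); SAME short names in the sibling namespace `…BalabanUVNodesN11FluctTruncationChi` (consumers switch by namespace);
the 12 centre-FREE declarations of the original are NOT copied — they are reused BY NAME (`open … (…)` below).  At `χ := chiβOfRecord₁₃ θ` every statement here is
DEFINITIONALLY the landed one ([Ax-3b]'s `rfl` receipts); at `χ := chiβOfRecord₁₃Ax θ` it is what the Ax-record's N11 machine reads.  Nothing of record edited (body-freeze №460 (2)).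

HONEST FRAMING.  Count-neutral kernel re-elaboration of landed N11 bookkeeping∕estimates in a parameter; every HYPOTHESIS of the original stays a hypothesis; nothing of
Bałaban asserted beyond what the original file proves; N11 NOT discharged; K-items untouched; counts unmoved.  One finite `𝕋⁴_{L^K}` programme at fixed `ε = L^{−K}` —
NOT ℝ⁴, NOT OS, NOT a mass gap, NOT Clay.  No `sorry`∕`instance`∕`notation`.  Sources: as the original module, plus [I] = [Balaban1987RG1] (2.9) p.266 (the cut-off's centre).
-/

noncomputable section

open MeasureTheory
open scoped BigOperators Matrix.Norms.L2Operator

namespace Summit.QuantumFields.YangMills.Theorems.BalabanUVNodesN11FluctTruncationChi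

open Summit.QuantumFields.YangMills.Theorems.BalabanUVNodesN11FluctTruncation (genOp_congr_rel tkBranchOfRecord_congr_rel tkBranchOfRecord_congr_on_fluctFree TkOfRecord_congr_on_fluctFree sect2Slot_truncTermValues hasSect2FormAtZS_truncTermValues hasSect2FormAEZS_iff_exists_local hasSect2FormTAEZS_iff_exists_local tLaw₁₃CoPH_iff_exists_local clause_succ_rePinH_of_Omega_empty_of_isFluctLocal_of_clause_of_integrable clause_succ_rePinH_truncTermValues_of_Omega_empty_of_clause_of_integrable exists_local_witness_clause_succ_rePinH_of_sLaw₁₃CoPH)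
open Literature.MathematicalPhysics.QuantumFieldTheory.Balaban1983to89 T4Continuum Node00 Node00.Tk DagBinding
open B15DeterminingSets
open T4AdjointCovariance (JCfg insA)
open BalabanUVNodesN11FluctTruncationDefs
open BalabanUVNodesN11RePinnedParamDefs hiding rePinH zhAt_rePinH zhAt_rePinH_eq_init_of_Omega_empty zhAt_rePinH_ζ0_univ_pairCfgAt zhUnity_rePinH
open BalabanUVNodesN11RePinnedParamDefsChi
open BalabanUVNodesN11NoExpansionGeneralStepRePinnedIntegrable (clause_succ_rePinH_of_Omega_empty_of_oldBranch_of_clause_of_integrable)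

variable {F : T4Family} {N : ℕ} [NeZero N]

/-! ## §1  Relational congruence of 11a's operator algebra -/

/-! ## §2  The §2 slot of the truncated term values IS the slot -/

/-! ## §3  The §2 predicates over history-indexed data have `k`-local witnesses -/

section Record

variable (θ : Stage13HParams F N) (χ : ChiSlot F N) (p : B12.RunParams)

/-- **★★ `SLaw₁₃CoPH θ p k` HAS A `k`-LOCAL WITNESS FAMILY** (and conversely, trivially): the 𝐒-law of record at level `k` holds iff the post-𝐑 slot family has the
§2 form with term values ALL of whose members are `k`-local in the fluctuation variables. [cite: Balaban1988Convergent, (2.18) p.257, Thm 1 p.262, (2.40)–(2.41) p.261] -/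
theorem sLaw₁₃CoPH_iff_exists_local (k : ℕ) :
    SLaw₁₃CoPHChi F N θ χ p k ↔
      ∃ (t : SeqOfRecord F θ.ν θ.τ9.M (gOfRecord₁₃Chi F N θ.toStage13Params χ p) p.K k → Sect2.TermValues (F.P p.K) (MatA N) (FluctV N) θ.τ9.M)
        (Ek : SeqOfRecord F θ.ν θ.τ9.M (gOfRecord₁₃Chi F N θ.toStage13Params χ p) p.K k → ℝ),
        HasSect2FormAtZS F N (FluctV N) p.K (settingOfRecord₁₃Chi F N θ.toStage13Params χ p) k (θ.rzAtChi χ p) (WtOfRecord₁₃HChi F N θ χ p)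
            (UbgOfRecord₁₃CoPChi F N θ.toStage13Params χ p k)
            (fun s t => Sect2.LawsRT (sect2TowerOfRecord F N (FluctV N) p.K (settingOfRecord₁₃Chi F N θ.toStage13Params χ p) (θ.rzAtChi χ p s) s t)
              (settingOfRecord₁₃Chi F N θ.toStage13Params χ p).lf k)
            (slotsOfRecord F N θ.ν θ.τ9 (EOfRecord₁₃Chi F N θ.toStage13Params χ) (wOfRecord₉ F N θ.toStage9Params) θ.ppSel p
              (gOfRecord₁₃Chi F N θ.toStage13Params χ p) k) t Ek ∧
          ∀ s, IsFluctLocal k (t s) :=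
  (sLaw₁₃CoPH_iff_chi F N θ χ p k).trans (hasSect2FormAEZS_iff_exists_local _ k _ _ _ _)

end Record

/-! ## §4  ★★★ D's off-diagonal residue with (hA) eliminated — PER-WITNESS forms (no binder quantifies over all term families) -/

end Summit.QuantumFields.YangMills.Theorems.BalabanUVNodesN11FluctTruncationChi

end



/-!
# χ-GENERIC RE-ISSUE (WORK ORDER RC-1 «RE-CENTRE THE RECORD», director-ym №462 (B) ∕ №467 (D)) of `BalabanUVNodesN11OldBranchIntegrableOfDominated`

Cell `pub-ymgap` (HUMAN RULING D-0062, Track A), seat `pub-ymgap-dag-n11-d` (N11 [B14] s2; N11-σ campaign, `N11-G44-RC1-REACH-CENSUS.md`).  The CENTRE-TYPED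
declarations of `BalabanUVNodesN11OldBranchIntegrableOfDominated` (those whose statement reads the (2.9) cut-off centre through `gOfRecord₁₃ ∕ EOfRecord₁₃ ∕ Provisos₁₃… ∕ T∕SLaw₁₃… ∕
UbgOfRecord₁₃… ∕ WtOfRecord₁₃… ∕ datum∕tower∕coreOfRecord₁₃…`) RE-ISSUED VERBATIM in the β-slot `χ : ChiSlot F N` over [Ax-3b]∕[Ax-3c]∕[Ax-3d]'s χ-generic carriers
(`Node00/Record13Chi` ∕ `Record13CoPHChi` ∕ `Record13SepCoPHChi`): σ = (binder `(χ : ChiSlot F N)` after `θ`; Node00 defs `X ↦ XChi … χ`; Node00 rows `Y ↦ Y_chi`;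
this lane's sibling modules `…Chi` for Summits-side dependencies); SAME short names in the sibling namespace `…BalabanUVNodesN11OldBranchIntegrableOfDominatedChi` (consumers switch by namespace);
the 4 centre-FREE declarations of the original are NOT copied — they are reused BY NAME (`open … (…)` below).  At `χ := chiβOfRecord₁₃ θ` every statement here is
DEFINITIONALLY the landed one ([Ax-3b]'s `rfl` receipts); at `χ := chiβOfRecord₁₃Ax θ` it is what the Ax-record's N11 machine reads.  Nothing of record edited (body-freeze №460 (2)).

HONEST FRAMING.  Count-neutral kernel re-elaboration of landed N11 bookkeeping∕estimates in a parameter; every HYPOTHESIS of the original stays a hypothesis; nothing of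
Bałaban asserted beyond what the original file proves; N11 NOT discharged; K-items untouched; counts unmoved.  One finite `𝕋⁴_{L^K}` programme at fixed `ε = L^{−K}` —
NOT ℝ⁴, NOT OS, NOT a mass gap, NOT Clay.  No `sorry`∕`instance`∕`notation`.  Sources: as the original module, plus [I] = [Balaban1987RG1] (2.9) p.266 (the cut-off's centre).
-/

noncomputable section

open MeasureTheory
open scoped BigOperators ENNReal NNReal Matrix.Norms.L2Operator

namespace Summit.QuantumFields.YangMills.Theorems.BalabanUVNodesN11OldBranchIntegrableOfDominatedChi

open Summit.QuantumFields.YangMills.Theorems.BalabanUVNodesN11OldBranchIntegrableOfDominated (integrable_oldBranch_rePinH_of_dominated exists_local_witness_clause_succ_rePinH_of_sLaw₁₃CoPH_of_dominated sA_init_eq_empty_of_allLarge rows_of_allLarge)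
open Literature.MathematicalPhysics.QuantumFieldTheory.Balaban1983to89 T4Continuum T4NestedCovariance Node00 Node00.Tk DagBinding
open B15DeterminingSets
open BalabanUVNodesN11TkBranchMassBound (integrable_tkBranchOfRecord_baseCfg_of_dominated)
open BalabanUVNodesN11DiagonalOldBranchMeasurableChi (measurable_WtOfRecord₁₃H_ζ measurable_WtOfRecord₁₃H_w)
open BalabanUVNodesN11RePinnedOldBranchMeasurable (measurable_zhAt_quad_rePinH)
open BalabanUVNodesN11RePinnedOldBranchMeasurableChi (measurable_zhAt_ζ0_rePinH_of_provisos)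
open BalabanUVNodesN11NoExpansionDiagonalCoPHChi (WtOfRecord₁₃H_eq_tkWeightsOfRecordP)
open BalabanUVNodesN11NoExpansionDiagonalAtZ (tkWeightsOfRecordP_ζ_apply)
open BalabanUVNodesN11RePinnedParamDefs hiding rePinH zhAt_rePinH zhAt_rePinH_eq_init_of_Omega_empty zhAt_rePinH_ζ0_univ_pairCfgAt zhUnity_rePinH
open BalabanUVNodesN11RePinnedParamDefsChi
open BalabanUVNodesN11FluctTruncationDefs
open BalabanUVNodesN11FluctTruncationGraph (exists_local_witness_clause_succ_rePinH_of_sLaw₁₃CoPH_of_graph)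

variable {F : T4Family} {N : ℕ} [NeZero N]

/-! ## §1  Print's partition of unity bounds the residual factor by `1` -/

section Unity

variable (θ : Stage13HParams F N) (χ : ChiSlot F N) (p : B12.RunParams)

/-- **`0 ≤ ζ0_j(Y) ≤ 1` FROM THE LAWS AND THE PARTITION OF UNITY**: a nonnegative family summing to `1` over the regions `Y` is termwise `≤ 1`.
[cite: Balaban1988Convergent, (3.16)–(3.20) pp.268–269 (bookkeeping)] -/
theorem zhAt_ζ0_le_one_of_unity (hZ : ∀ (p : B12.RunParams) (n : ℕ) (Ω Λ : ℕ → Set (Site (F.P p.K) 0)), (θ.Zh p n Ω Λ).Laws) (hU : θ.ZhUnity F N) {n : ℕ}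
    (s : SeqOfRecord F θ.ν θ.τ9.M (gOfRecord₁₃Chi F N θ.toStage13Params χ p) p.K n) (j : ℕ) (Y : Set (Site (F.P p.K) 0))
    (ω : MultiCfg (F.P p.K) (SU N) (FluctV N)) : (θ.zhAtChi χ p s).ζ0 j Y ω ≤ 1 := by
  have h1 := hU p n s.Ω s.Λ j ω
  have hle : (θ.Zh p n s.Ω s.Λ).ζ0 j Y ω ≤ ∑ᶠ Y' : Set (Site (F.P p.K) 0), (θ.Zh p n s.Ω s.Λ).ζ0 j Y' ω :=
    single_le_finsum Y (Set.toFinite _) fun Y' => (hZ p n s.Ω s.Λ).zeta0_nonneg j Y' ω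
  rw [h1] at hle
  exact hle

end Unity

/-! ## §2  ★★ `hIB` for one old branch of record, generic `θ`, from the structural rows -/

section Generic

variable (θ : Stage13HParams F N) (χ : ChiSlot F N) (p : B12.RunParams)

/-- **★★ THE OLD BRANCH OF RECORD IS `dU_k`-INTEGRABLE FROM THE STRUCTURAL ROWS**, generic `θ : Stage13HParams`, any history `s′` of length `k+1`, any branch `S`, any
operand `Φ` of r11's shape: (i) residual rows — `zhLaws`, `ZhUnity`, measurability of `ζ0_j(Y)` and `quad_j(Λ′)` of the residual serving `s′`; (ii) A-fibre domination of
the weights `χ_A(Y,S)·e^{−½quad}` of record by an integrable `ŵ_j` of the integrated fluctuation variables; (iii) `Φ` measurable on the multiscale configuration space with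
`0 ≤ Φ ≤ CΦ`.  Then `U₀ ↦ 𝐓_k(init s′, S)[Φ](base_k U₀)` is integrable for product Haar (`…N11TkBranchMassBound` at `W := WtOfRecord₁₃H θ p s′`).
[cite: Balaban1988Convergent, (2.18) p.257, (2.20)–(2.21) p.258, (3.16)–(3.21) pp.268–269, (3.23)–(3.24) p.270] -/
theorem integrable_oldBranch_of_dominated
    (hZ : ∀ (p : B12.RunParams) (n : ℕ) (Ω Λ : ℕ → Set (Site (F.P p.K) 0)), (θ.Zh p n Ω Λ).Laws) (hU : θ.ZhUnity F N) {k : ℕ}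
    (s : SeqOfRecord F θ.ν θ.τ9.M (gOfRecord₁₃Chi F N θ.toStage13Params χ p) p.K (k + 1)) (S : ℕ → Set (Site (F.P p.K) 0))
    (hζm : ∀ j (Y : Set (Site (F.P p.K) 0)), Measurable ((θ.zhAtChi χ p s).ζ0 j Y))
    (hqm : ∀ j (Λ' : Set (Site (F.P p.K) 0)), Measurable ((θ.zhAtChi χ p s).quad j Λ'))
    (ŵ : (j : ℕ) → (↥(Set.toFinite (B10Eq42TorusConstraint.bondsIn j ((s.init.Λ (j + 1))ᶜ ∩ s.init.Ω (j + 1)))).toFinset → FluctV N) → ℝ≥0∞) (hŵm : ∀ j, Measurable (ŵ j)) (Cw : ℕ → ℝ≥0)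
    (hCw : ∀ j, ∫⁻ a, ŵ j a ∂(Measure.pi fun _ : ↥(Set.toFinite (B10Eq42TorusConstraint.bondsIn j ((s.init.Λ (j + 1))ᶜ ∩ s.init.Ω (j + 1)))).toFinset => (volume : Measure (FluctV N))) ≤ Cw j)
    (hdom : ∀ j ω, ENNReal.ofReal ((WtOfRecord₁₃HChi F N θ χ p s).w j (s.init.Λ (j + 1)) ((s.init.Λ (j + 1))ᶜ ∩ s.init.Ω (j + 1)) (S (j + 1)) ω) ≤
      ŵ j (fun b : ↥(Set.toFinite (B10Eq42TorusConstraint.bondsIn j ((s.init.Λ (j + 1))ᶜ ∩ s.init.Ω (j + 1)))).toFinset => (ω j).2 b))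
    {Φ : SFluct (F.P p.K) (FluctV N) → MSField (F.P p.K) (SU N) → ℝ}
    (hΦm : Measurable fun ω : MultiCfg (F.P p.K) (SU N) (FluctV N) => Φ (S, fun j => (ω j).2) (fun j => (ω j).1))
    (hΦ0 : ∀ a U, 0 ≤ Φ a U) (CΦ : ℝ) (hΦle : ∀ a U, Φ a U ≤ CΦ) :
    Integrable (fun U₀ : GaugeField (F.P p.K) k (SU N) =>
      tkBranchOfRecord F N (FluctV N) θ.ν θ.τ9.M _ p.K (WtOfRecord₁₃HChi F N θ χ p s) s.init S k
        (fun ω => Φ (S, fun j => (ω j).2) (fun j => (ω j).1)) (baseCfg (V := FluctV N) k U₀)) (fieldMeasure (F.P p.K) k (SU N)) := by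
  have hWlaws : (WtOfRecord₁₃HChi F N θ χ p s).Laws := WtOfRecord₁₃H_laws_chi hZ p s
  refine integrable_tkBranchOfRecord_baseCfg_of_dominated θ.ν θ.τ9.M (gOfRecord₁₃Chi F N θ.toStage13Params χ p) p.K (WtOfRecord₁₃HChi F N θ χ p s) s.init S
    (fun j => measurable_WtOfRecord₁₃H_ζ θ χ p s j _ (hζm j _)) (fun j ω => hWlaws.zeta_nonneg j _ ω) (fun j ω => ?_)
    (fun j => measurable_WtOfRecord₁₃H_w θ χ p s j _ _ _ (hqm j _)) (fun j ω => TkWeights.w_nonneg hWlaws j _ _ _ ω) ŵ hŵm hdom Cw hCw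
    hΦm (fun ω => hΦ0 _ _) CΦ (fun ω => hΦle _ _) k
  -- `ζ_j(Y) = ζ0_j(Y) ≤ 1`
  rw [WtOfRecord₁₃H_eq_tkWeightsOfRecordP, tkWeightsOfRecordP_ζ_apply]
  exact zhAt_ζ0_le_one_of_unity θ χ p hZ hU s j _ ω

end Generic

/-! ## §3  ★★ At the re-pinned parameter: the residual rows are theorems -/

/-! ## §4  ★★★ The `SLaw`-keyed witness-first face: `hIB` replaced by the two structural rows -/

/-! ## §5  A6 exhibit: along the all-large-field diagonal both rows ARE inhabited at `rePinH θ` -/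

end Summit.QuantumFields.YangMills.Theorems.BalabanUVNodesN11OldBranchIntegrableOfDominatedChi

end



/-!
# χ-GENERIC RE-ISSUE (WORK ORDER RC-1 «RE-CENTRE THE RECORD», director-ym №462 (B) ∕ №467 (D)) of `BalabanUVNodesN11AFibreDominationOfCoercive`

Cell `pub-ymgap` (HUMAN RULING D-0062, Track A), seat `pub-ymgap-dag-n11-d` (N11 [B14] s2; N11-σ campaign, `N11-G44-RC1-REACH-CENSUS.md`).  The CENTRE-TYPED
declarations of `BalabanUVNodesN11AFibreDominationOfCoercive` (those whose statement reads the (2.9) cut-off centre through `gOfRecord₁₃ ∕ EOfRecord₁₃ ∕ Provisos₁₃… ∕ T∕SLaw₁₃… ∕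
UbgOfRecord₁₃… ∕ WtOfRecord₁₃… ∕ datum∕tower∕coreOfRecord₁₃…`) RE-ISSUED VERBATIM in the β-slot `χ : ChiSlot F N` over [Ax-3b]∕[Ax-3c]∕[Ax-3d]'s χ-generic carriers
(`Node00/Record13Chi` ∕ `Record13CoPHChi` ∕ `Record13SepCoPHChi`): σ = (binder `(χ : ChiSlot F N)` after `θ`; Node00 defs `X ↦ XChi … χ`; Node00 rows `Y ↦ Y_chi`;
this lane's sibling modules `…Chi` for Summits-side dependencies); SAME short names in the sibling namespace `…BalabanUVNodesN11AFibreDominationOfCoerciveChi` (consumers switch by namespace);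
the 14 centre-FREE declarations of the original are NOT copied — they are reused BY NAME (`open … (…)` below).  At `χ := chiβOfRecord₁₃ θ` every statement here is
DEFINITIONALLY the landed one ([Ax-3b]'s `rfl` receipts); at `χ := chiβOfRecord₁₃Ax θ` it is what the Ax-record's N11 machine reads.  Nothing of record edited (body-freeze №460 (2)).

HONEST FRAMING.  Count-neutral kernel re-elaboration of landed N11 bookkeeping∕estimates in a parameter; every HYPOTHESIS of the original stays a hypothesis; nothing of
Bałaban asserted beyond what the original file proves; N11 NOT discharged; K-items untouched; counts unmoved.  One finite `𝕋⁴_{L^K}` programme at fixed `ε = L^{−K}` —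
NOT ℝ⁴, NOT OS, NOT a mass gap, NOT Clay.  No `sorry`∕`instance`∕`notation`.  Sources: as the original module, plus [I] = [Balaban1987RG1] (2.9) p.266 (the cut-off's centre).
-/

noncomputable section

open MeasureTheory
open scoped BigOperators ENNReal NNReal

namespace Summit.QuantumFields.YangMills.Theorems.BalabanUVNodesN11AFibreDominationOfCoerciveChi

open Summit.QuantumFields.YangMills.Theorems.BalabanUVNodesN11AFibreDominationOfCoercive (measurable_gaussFactor measurable_gaussMajorant lintegral_gaussFactor_eq lintegral_gaussFactor_ne_top lintegral_gaussMajorant_eq lintegral_gaussMajorant_ne_top exp_neg_half_le_gaussMajorant afibre_dominated_of_coercive afibre_dominated_of_coercive_tkWeightsOfRecord coercive_model afibre_rows_adm_of_coercive coercive_rePinH_of_bondsIn_eq_empty bondsIn_eq_empty_of_coercive_rePinH coercive_rePinH_iff_bondsIn_eq_empty)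
open Literature.MathematicalPhysics.QuantumFieldTheory (GaussianToolkit.lintegral_fintype_prod_eq_prod GaussianToolkit.lintegral_comp_smul
  GaussianToolkit.lintegral_exp_neg_norm_sq_div_two)
open Literature.MathematicalPhysics.QuantumFieldTheory.Balaban1983to89 T4Continuum Node00 Node00.Tk
open B15DeterminingSets (MSField)
open B10Eq42TorusConstraint (bondsIn)
open BalabanUVNodesN11OldBranchIntegrableOfDominatedChi (integrable_oldBranch_of_dominated)
open BalabanUVNodesN11RePinnedParamDefs hiding rePinH zhAt_rePinH zhAt_rePinH_eq_init_of_Omega_empty zhAt_rePinH_ζ0_univ_pairCfgAt zhUnity_rePinH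
open BalabanUVNodesN11RePinnedParamDefsChi

/-! ## §1  The Gaussian majorant on a finite product of Euclidean fibres -/

/-! ## §2  ★★ Generic 12a″ weights: coercivity of `quad` on the A-fibre ⇒ the domination row, for EVERY branch `S` -/

/-! ## §3  ★★ At the v1.7 `CoPH` record, GENERIC `θ`: the per-branch ∕ per-generation rows from ONE coercivity row on the history's `quad` -/

section Record

variable {F : T4Family} {N : ℕ} [NeZero N]
variable (θ : Stage13HParams F N) (χ : ChiSlot F N) (p : B12.RunParams)

/-- **★★ THE A-FIBRE DOMINATION ROWS OF p580601 §4 AT A GENERIC `θ`, FROM COERCIVITY**: for the history's weights `WtOfRecord₁₃H θ p s′` (12a″ over the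
residual `θ.zhAtChi χ p s′` serving `s′`), if at every generation `j` the form value `quad_j(Λ_{j+1}(init s′))` dominates `c_j·Σ_{b ∈ sA_j} ‖A_j(b)‖²` on the
A-fibre `sA_j = bondsIn j (Λᶜ_{j+1} ∩ Ω_{j+1})(init s′)` with `c_j > 0`, then for EVERY branch `S` and EVERY `j` the row «∃ ŵ, Measurable ŵ ∧ ∫⁻ ŵ ≠ ⊤ ∧
∀ ω, ofReal (w_j …) ≤ ŵ (A|_{sA_j})» holds — the binder `hW S _` of ★★★ `exists_local_witness_clause_succ_rePinH_of_sLaw₁₃CoPH_of_dominated` and of dag-n11-d's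
generic-θ specification, verbatim. [cite: Balaban1988Convergent, (2.18) p.257, (2.20)–(2.21) p.258, (3.21) p.269, (3.23) p.270; Balaban1987RG1, (2.11) p.267 (shape of the row)] -/
theorem afibre_rows_of_coercive {k : ℕ} (s : SeqOfRecord F θ.ν θ.τ9.M (gOfRecord₁₃Chi F N θ.toStage13Params χ p) p.K (k + 1))
    (hcoer : ∀ j : ℕ, ∃ c : ℝ, 0 < c ∧ ∀ ω : MultiCfg (F.P p.K) (SU N) (FluctV N),
      c * ∑ b ∈ (Set.toFinite (bondsIn j ((s.init.Λ (j + 1))ᶜ ∩ s.init.Ω (j + 1)))).toFinset, ‖(ω j).2 b‖ ^ 2 ≤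
        (θ.zhAtChi χ p s).quad j (s.init.Λ (j + 1)) ω)
    (S : ℕ → Set (Site (F.P p.K) 0)) (j : ℕ) :
    ∃ ŵ : (↥(Set.toFinite (bondsIn j ((s.init.Λ (j + 1))ᶜ ∩ s.init.Ω (j + 1)))).toFinset → FluctV N) → ℝ≥0∞, Measurable ŵ ∧
      (∫⁻ a, ŵ a ∂(Measure.pi fun _ : ↥(Set.toFinite (bondsIn j ((s.init.Λ (j + 1))ᶜ ∩ s.init.Ω (j + 1)))).toFinset =>
        (volume : Measure (FluctV N)))) ≠ ⊤ ∧
      ∀ ω, ENNReal.ofReal ((WtOfRecord₁₃HChi F N θ χ p s).w j (s.init.Λ (j + 1)) ((s.init.Λ (j + 1))ᶜ ∩ s.init.Ω (j + 1)) (S (j + 1)) ω) ≤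
        ŵ (fun b : ↥(Set.toFinite (bondsIn j ((s.init.Λ (j + 1))ᶜ ∩ s.init.Ω (j + 1)))).toFinset => (ω j).2 b) := by
  obtain ⟨c, hc, h⟩ := hcoer j
  exact afibre_dominated_of_coercive θ.ν θ.A₁ p (gOfRecord₁₃Chi F N θ.toStage13Params χ p) (θ.zhAtChi χ p s) j _ _ _ hc h

/-! ## §4  ★★★ `hIB` for one old branch of record, generic `θ`: the domination binders DISCHARGED by the coercivity row -/

/-- **★★★ THE OLD BRANCH OF RECORD IS `dU_k`-INTEGRABLE FROM COERCIVITY OF THE RESIDUAL's `quad`**, generic `θ : Stage13HParams`, any history `s′` of length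
`k+1`, any branch `S`, any operand `Φ` of r11's shape — p580601 §2 ★★ `integrable_oldBranch_of_dominated` with its five domination binders `ŵ hŵm Cw hCw hdom`
REPLACED by the one pointwise row `hcoer`: (i) residual rows — `zhLaws`, `ZhUnity`, measurability of `ζ0_j(Y)`∕`quad_j(Λ′)`; (ii′) COERCIVITY —
`c_j·Σ_{b∈sA_j} ‖A_j(b)‖² ≤ quad_j(Λ_{j+1})` ([I]'s positivity of `𝒬_j`; displayed); (iii) `Φ` measurable with `0 ≤ Φ ≤ CΦ`.  Then
`U₀ ↦ 𝐓_k(init s′, S)[Φ](base_k U₀)` is integrable for product Haar. [cite: Balaban1988Convergent, (2.18) p.257, (2.20)–(2.21) p.258, (3.16)–(3.21) pp.268–269, (3.23)–(3.24) p.270; Balaban1987RG1, (2.11) p.267 (shape of the row)] -/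
theorem integrable_oldBranch_of_coercive
    (hZ : ∀ (p : B12.RunParams) (n : ℕ) (Ω Λ : ℕ → Set (Site (F.P p.K) 0)), (θ.Zh p n Ω Λ).Laws) (hU : θ.ZhUnity F N) {k : ℕ}
    (s : SeqOfRecord F θ.ν θ.τ9.M (gOfRecord₁₃Chi F N θ.toStage13Params χ p) p.K (k + 1)) (S : ℕ → Set (Site (F.P p.K) 0))
    (hζm : ∀ j (Y : Set (Site (F.P p.K) 0)), Measurable ((θ.zhAtChi χ p s).ζ0 j Y))
    (hqm : ∀ j (Λ' : Set (Site (F.P p.K) 0)), Measurable ((θ.zhAtChi χ p s).quad j Λ'))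
    (hcoer : ∀ j : ℕ, ∃ c : ℝ, 0 < c ∧ ∀ ω : MultiCfg (F.P p.K) (SU N) (FluctV N),
      c * ∑ b ∈ (Set.toFinite (bondsIn j ((s.init.Λ (j + 1))ᶜ ∩ s.init.Ω (j + 1)))).toFinset, ‖(ω j).2 b‖ ^ 2 ≤
        (θ.zhAtChi χ p s).quad j (s.init.Λ (j + 1)) ω)
    {Φ : SFluct (F.P p.K) (FluctV N) → MSField (F.P p.K) (SU N) → ℝ}
    (hΦm : Measurable fun ω : MultiCfg (F.P p.K) (SU N) (FluctV N) => Φ (S, fun j => (ω j).2) (fun j => (ω j).1))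
    (hΦ0 : ∀ a U, 0 ≤ Φ a U) (CΦ : ℝ) (hΦle : ∀ a U, Φ a U ≤ CΦ) :
    Integrable (fun U₀ : GaugeField (F.P p.K) k (SU N) =>
      tkBranchOfRecord F N (FluctV N) θ.ν θ.τ9.M _ p.K (WtOfRecord₁₃HChi F N θ χ p s) s.init S k
        (fun ω => Φ (S, fun j => (ω j).2) (fun j => (ω j).1)) (baseCfg (V := FluctV N) k U₀)) (fieldMeasure (F.P p.K) k (SU N)) := by
  choose ŵ hŵm hŵfin hdom using afibre_rows_of_coercive θ χ p s hcoer S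
  exact integrable_oldBranch_of_dominated θ χ p hZ hU s S hζm hqm ŵ hŵm
    (fun j => (∫⁻ a, ŵ j a ∂(Measure.pi fun _ : ↥(Set.toFinite (bondsIn j ((s.init.Λ (j + 1))ᶜ ∩ s.init.Ω (j + 1)))).toFinset =>
      (volume : Measure (FluctV N)))).toNNReal)
    (fun j => le_of_eq (ENNReal.coe_toNNReal (hŵfin j)).symm) hdom hΦm hΦ0 CΦ hΦle

end Record

/-! ## §5  LOCATED: at the certificate `rePinH θ` the coercivity row singles out the all-large diagonal -/

end Summit.QuantumFields.YangMills.Theorems.BalabanUVNodesN11AFibreDominationOfCoerciveChi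

end

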